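import Literature.MathematicalPhysics.QuantumFieldTheory.Balaban1983to89.B9Thm311DeltaAFrustratedWitness

/-!
# Balaban [B9], Thm 3.11 p. 416 ∕ (3.26)–(3.27) p. 395 OUTSIDE the class (3.35): `Δ_a(U)` IS NOT A UNIT at the
# HALF-FRUSTRATED background — a kernel certificate for the binder «`Δ_a(U)` invertible for every G-valued `U`»

T. Bałaban, *Propagators for lattice gauge theories in a background field*, Commun. Math. Phys. **99** (1985) 389–434
[`Balaban1985BackgroundPropagators`, "B9"].

statement-level skeleton of published theorems with citation tags; proofs where landed; nothing here is a claim about the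
Yang–Mills mass gap

THE PRINTED LOCUS.  Thm 3.11 p. 416 (l.15–17, verbatim): *«Theorem 3.11. Under the assumptions of the Theorems 3.1–3.10 (i.e. for M sufficiently large
and α₀ sufficiently small) the operators Δ′_a, G′, (Q′G′²Q′*)⁻¹, Δ_a, G are positive definite.»* — the restriction of `U` to the class (3.35) p. 396 enters
THROUGH «the assumptions of the Theorems 3.1–3.10» (Thm 3.1 p. 397: *«for an arbitrary configuration U satisfying the regularity condition (3.35) with
Mα₀ ≦ a₀»*); (3.26) p. 395 `Δ_a(U) = Δ(U) + D_U R(U) D*_U + Q*(U) a Q(U)`; (3.27) p. 395 `G(U) = Δ_a(U)⁻¹`, introduced on pp. 394–395 with the words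
*«We do not know yet if the operators in the above formula are well defined. Assuming some regularity of the configuration U it can be easily shown that the
operator Δ′_a is positive.»* (quotation items checked by the [B9] page owner lit-balaban-r06, 2026-08-29).

WHY THIS FILE (cell `pub-ymgap`, seat dag-n06-j gen 30; N06 rows 15–17 lineage; count-neutral).  Row 17 of the N06 certificate is Theorem 3.11.
Gen 10 of this seat (`B9Thm311DeltaAFrustratedWitness`) recorded the negative side «without (3.35), `Δ_a(U)` is not positive definite» at the
maximally frustrated `ℤ₂` background.  The Sect. B assembly of record (dag-n06-d, `B9SectBStepUOfMembers.sectBStepU_C37GY_unitary_of_members`,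
2026-08-29) and the G-frame files it consumes display the stronger law
`hunitA : ∀ j U, GVal G (f j).toKIdx U → IsUnit (deltaAY (f j).toKIdx (parSymY …) (parBY …) (GpY … (parSymY …)) U)` — `Δ_a(U)` a unit at EVERY
`G`-valued background.  THIS FILE is the kernel certificate that, for the structure group of record `G = SU(N)` (`N ≥ 2`, dimension `d + 1 ≥ 2`), that
display is UNSATISFIABLE at every member: there is an `SU(N)`-valued background at which NODE 00's `Δ_a(U)` (`Node00.deltaAY`, any transport table of
the site sector, any site-propagator letter, the taxicab bond transporters `parBY` or any table transporting inside the cyclic group of the witness)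
has a non-zero kernel vector, hence is not a unit, and (3.27)'s total letter `GAY := Ring.inverse Δ_a` reads `0` there.

THE WITNESS (§1–§2).  The HALF-FRUSTRATED background `W_ν(x) := g` where gen 10's staircase sign `Π_{κ<ν}(−1)^{x_κ}` is `−1`, `:= 1` elsewhere — a
«square root» of the frustrated background: every plaquette holonomy is `g` or `g⁻¹` (§1 `holY_halfCfg`), so `Re W(∂p) = ½(g + g⁻¹)` on EVERY plaquette.
For `g := diag(i, −i, 1, …, 1) ∈ SU(N)` and the direction `E := e₀₀` one has `E·g = g·E`, `E·(g + g⁻¹) = 0`: on bond functions `a ⊗ E` (`a` real) every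
transporter acts trivially (all transporters are powers of `g`), the Jordan insertion `𝒦_W` of (3.10) kills `(D_W(a ⊗ E))(p) = (∂a)(p)·E`, and the commutator
part `Δ′₂(W)` vanishes on `a ⊗ E` (`Im W(∂p)` is a power-combination of `g`, commuting with `E`) — so the Wilson Hessian `Δ(W)` VANISHES on `a ⊗ E` (§2
`hessY_liftY_eq_zero`).  Gen 10's census count `|sites| + |𝔅| < |bonds|` gives a real `a ≠ 0` with flat `∂*a = 0`, `Qa = 0`; then `D*_W(a ⊗ E) = 0`,
`Q(W)(a ⊗ E) = 0` and (3.26) returns `Δ_a(W)(a ⊗ E) = Δ(W)(a ⊗ E) = 0` (§3).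

WHAT IS PROVED (kernel-checked, 0 sorry).  §1 `halfCfgV ∕ halfCfg` and its holonomies; §2 the E-line calculus at any background whose values are powers
of `g` (`trLiftY_liftY_of_commute`, `divY_liftY`, `curlY_liftY`, `QY_liftY`, `jordanY_liftY_eq_zero`, `curv2Y_liftY_eq_zero`, ★ `hessY_liftY_eq_zero`);
§3 ★ `exists_real_kernel`, ★★ `deltaAY_liftY_eq_zero`, ★★★ `not_isUnit_deltaAY_of` ∕ `GAY_eq_zero_of` (abstract `g, E`); §4 ★★★ `not_isUnit_deltaAY_halfCfg`
(+ `_parBY`), ★★ `GAY_halfCfg_eq_zero`; §5 the matrix witness `gSU N = diag(i, −i, 1, …)` ∈ `SU(N)` (`N ≥ 2`), `eSU N = e₀₀`, ★★★ `exists_su_not_isUnit_deltaAY`,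
★★★ `not_forall_su_isUnit_deltaAY_parSymY` (ONE member's instance of the displayed `hunitA` at the record's letters `parSymY ∕ parBY ∕ GpY`, NEGATED),
`not_forall_mem_isUnit_deltaAY` (any `G ∋ gSU N`).

HONEST SCOPE.  A kernel certificate about NODE 00's letters at ONE background OUTSIDE the class (3.35) (`|W(∂p) − 1| = √2·…` on every plaquette — it misses
(3.35) for every `α₀` of record, as it must: Theorem 3.11 holds there).  It says nothing against [B9]; it says that a binder quantified over ALL `G`-valued
backgrounds is not the printed hypothesis (print restricts `U` to (3.35) p. 396, via Thm 3.1 p. 397 ∕ Thm 3.11 p. 416) and cannot be discharged; the class-keyed reading (invertibility on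
(3.35)–(3.36), where `B9Thm310DeltaAIsUnitOfExpansion.isUnit_deltaAY_of_coverCubes` and Theorem 3.11 supply it) is the satisfiable one.  Count-neutral; N06 NOT
discharged; nothing continuum ∕ OS ∕ mass-gap ∕ Clay.  No `sorry`, no `axiom`, no `instance`, no `notation`.  `--supports stmt-QuantumFields-27364`.

RELATED IN THE TREE, NOT DUPLICATED (searched 2026-08-29: `rg 'not_isUnit_deltaAY|halfCfg'` = 0): `B9Thm311DeltaAFrustratedWitness` (gen 10: `¬ PosDefTr`, the
staircase signs and the census count — USED), `B9Thm311DeltaAGaugeOrbit` (gen 10: orbit transport), `B9Thm311SingularInFrameClassCubeZd` (dag-n06-w3: a kernel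
vector for r06's `opsAllZd` at a `ℤᵈ` cube member INSIDE the frame class — a different object and a different locus), `B9Thm310DeltaAIsUnitOfExpansion`
(invertibility from the (3.105) cover, the positive side).
-/

noncomputable section

namespace Literature.MathematicalPhysics.QuantumFieldTheory.Balaban1983to89.B9Thm311DeltaANotUnitWitness

open Literature.MathematicalPhysics.QuantumFieldTheory.Balaban1983to89
open Literature.MathematicalPhysics.QuantumFieldTheory.Balaban1983to89.B9Thm311DeltaAFrustratedWitness (stairSgn stairSgn_shift
  card_SiteY_add_card_IBondY_lt deltaAY_apply_of_divY_QY_eq_zero)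
open Node00 B6KLevelCensusIndexV1 B9BackgroundsKLevelV1 B6GlobalChartV1
open Literature.MathematicalPhysics.QuantumFieldTheory.Balaban1983to89.B7Prop2SpecialUnitary (specialUnitaryUnits)
open Literature.MathematicalPhysics.QuantumFieldTheory.Balaban1983to89.B9Eq39Adjoint (R)
open scoped Matrix

/-! ## §1 The half-frustrated background `W = √(frustrated)`: values in `{1, g}`, every plaquette holonomy in `{g, g⁻¹}` -/

section Torus

variable {P : Params} {𝔹 : Type} [Ring 𝔹]

variable (P) in
/-- ★ **THE HALF-FRUSTRATED BACKGROUND** `W_ν(x) = g` where the staircase sign `Π_{κ<ν}(−1)^{x_κ}` is `−1`, `W_ν(x) = 1` elsewhere (a «square root» of gen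
10's maximally frustrated `ℤ₂` background). [cite: Balaban1985BackgroundPropagators, (3.1) p.390, (3.35) p.396 (a configuration OUTSIDE the regularity class), dictionary] -/
def halfCfgV (g : 𝔹ˣ) : CfgV1 P 𝔹 := fun ν x => if stairSgn ν x = 1 then 1 else g

/-- the background's values are `1` or `g`. [cite: Balaban1985BackgroundPropagators, (3.1) p.390, bookkeeping] -/
theorem halfCfgV_apply_eq_or (g : 𝔹ˣ) (ν : Fin P.d) (x : Site P 0) : halfCfgV P g ν x = 1 ∨ halfCfgV P g ν x = g := by
  unfold halfCfgV
  split_ifs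
  · exact Or.inl rfl
  · exact Or.inr rfl

end Torus

section Index

variable {d ℓ : ℕ} {hd : 1 ≤ d + 1} {hL : Odd (ℓ + 1) ∧ 1 < ℓ + 1} {b₀ b₁ : ℝ}
variable {𝔸 : Type} [NormedRing 𝔸] [NormedAlgebra ℂ 𝔸] [CompleteSpace 𝔸]
variable (i : KIdx d ℓ hd hL b₀ b₁) (g : 𝔸ˣ)

/-- the half-frustrated background at a k-level index (NODE 00's carriers). [cite: Balaban1985BackgroundPropagators, (3.1) p.390, (3.35) p.396, dictionary] -/
def halfCfg : CfgY 𝔸 i := halfCfgV (PV d ℓ i.m i.K hd hL) g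

/-- its values are `1` or `g`. [cite: Balaban1985BackgroundPropagators, (3.1) p.390, bookkeeping] -/
theorem halfCfg_apply_eq_or (μ : Fin (d + 1)) (x : Site (PV d ℓ i.m i.K hd hL) 0) : halfCfg i g μ x = 1 ∨ halfCfg i g μ x = g :=
  halfCfgV_apply_eq_or (P := PV d ℓ i.m i.K hd hL) g μ x

/-- the half-frustrated background is `G`-valued for every subgroup `G ∋ g`. [cite: Balaban1985BackgroundPropagators, (3.35) p.396 («U with values in G»), bookkeeping] -/
theorem halfCfg_mem {G : Subgroup 𝔸ˣ} (hg : g ∈ G) (μ : Fin (d + 1)) (x : Site (PV d ℓ i.m i.K hd hL) 0) : halfCfg i g μ x ∈ G := by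
  rcases halfCfg_apply_eq_or i g μ x with h | h
  · rw [h]; exact one_mem G
  · rw [h]; exact hg

/-- in particular its values are powers of `g`. [cite: Balaban1985BackgroundPropagators, (3.1) p.390, bookkeeping] -/
theorem halfCfg_mem_zpowers (μ : Fin (d + 1)) (x : Site (PV d ℓ i.m i.K hd hL) 0) : halfCfg i g μ x ∈ Subgroup.zpowers g :=
  halfCfg_mem i g (Subgroup.mem_zpowers g) μ x

/-- ★ **EVERY PLAQUETTE HOLONOMY OF THE HALF-FRUSTRATED BACKGROUND IS `g` OR `g⁻¹`**: on `p = ⟨x, x+e_μ, x+e_μ+e_ν, x+e_ν⟩`, `μ < ν`, the two bonds of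
direction `μ` carry the same value (and commute with everything in sight), the two bonds of direction `ν` carry `g` and `1` in some order.
[cite: Balaban1985BackgroundPropagators, (3.1) p.390 (U(∂p)), (3.7) p.391] -/
theorem holY_halfCfg (p : PlaqY i) : holY i (halfCfg i g) p = g ∨ holY i (halfCfg i g) p = g⁻¹ := by
  have hne : (-1 : ℤˣ) ≠ 1 := by decide
  unfold holY halfCfg halfCfgV
  rw [stairSgn_shift, stairSgn_shift, if_pos p.hμν, if_neg (not_lt.mpr p.hμν.le), mul_one]
  rcases Int.units_eq_one_or (stairSgn p.μ p.src) with ha | ha <;>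
    rcases Int.units_eq_one_or (stairSgn p.ν p.src) with hb | hb <;>
    simp [ha, hb, hne]

/-- hence every holonomy is a power of `g`. [cite: Balaban1985BackgroundPropagators, (3.1) p.390, bookkeeping] -/
theorem holY_halfCfg_mem_zpowers (p : PlaqY i) : holY i (halfCfg i g) p ∈ Subgroup.zpowers g := by
  rcases holY_halfCfg i g p with h | h
  · rw [h]; exact Subgroup.mem_zpowers g
  · rw [h]; exact inv_mem (Subgroup.mem_zpowers g)

/-- `W(∂p) + W(∂p)⁻¹ = g + g⁻¹` on every plaquette. [cite: Balaban1985BackgroundPropagators, (3.7) p.391, bookkeeping] -/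
theorem val_holY_add_inv_halfCfg (p : PlaqY i) :
    (holY i (halfCfg i g) p : 𝔸) + ((holY i (halfCfg i g) p)⁻¹ : 𝔸ˣ) = (g : 𝔸) + ((g⁻¹ : 𝔸ˣ) : 𝔸) := by
  rcases holY_halfCfg i g p with h | h
  · rw [h]
  · rw [h, inv_inv, add_comm]

/-- ★ `Re W(∂p) = ½(g + g⁻¹)` ON EVERY PLAQUETTE. [cite: Balaban1985BackgroundPropagators, (3.7) p.391] -/
theorem reHolY_halfCfg (p : PlaqY i) : reHolY i (halfCfg i g) p = (1 / 2 : ℂ) • ((g : 𝔸) + ((g⁻¹ : 𝔸ˣ) : 𝔸)) := by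
  rw [reHolY, val_holY_add_inv_halfCfg]

end Index

/-! ## §2 The E-line calculus at a background with values in the cyclic group of `g`, for a direction `E` commuting with `g` -/

section ELines

variable {d ℓ : ℕ} {hd : 1 ≤ d + 1} {hL : Odd (ℓ + 1) ∧ 1 < ℓ + 1} {b₀ b₁ : ℝ}
variable {𝔸 : Type} [NormedRing 𝔸] [NormedAlgebra ℂ 𝔸] [CompleteSpace 𝔸]
variable (i : KIdx d ℓ hd hL b₀ b₁) {g : 𝔸ˣ} {E : 𝔸} {U : CfgY 𝔸 i}

omit [NormedAlgebra ℂ 𝔸] [CompleteSpace 𝔸] in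
/-- a direction commuting with `g` commutes with every power of `g`. [cite: Balaban1985BackgroundPropagators, (3.1) p.390 («R(U)X = UXU⁻¹»), bookkeeping] -/
theorem commute_of_mem_zpowers (hEg : Commute E (g : 𝔸)) {T : 𝔸ˣ} (hT : T ∈ Subgroup.zpowers g) : Commute E (T : 𝔸) := by
  obtain ⟨k, rfl⟩ := Subgroup.mem_zpowers_iff.mp hT
  exact hEg.units_zpow_right k

omit [CompleteSpace 𝔸] in
/-- transport by a unit commuting with `E` is trivial on the line `ℂE`: `R(T)(cE) = cE`. [cite: Balaban1985BackgroundPropagators, (3.1) p.390 («R(U)X = UXU⁻¹»)] -/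
theorem R_smul_of_commute {T : 𝔸ˣ} (h : Commute E (T : 𝔸)) (c : ℂ) : R T (c • E) = c • E := by
  rw [R, mul_smul_comm, smul_mul_assoc, ← h.eq, Units.mul_inv_cancel_right]

omit [CompleteSpace 𝔸] in
/-- ★ a transported lift whose transporters commute with `E` acts on `f ⊗ E` as the flat kernel: `M♯_T(f ⊗ E) = (Mf) ⊗ E`.
[cite: Balaban1985BackgroundPropagators, (3.3) p.390, (3.12)–(3.14) pp.392–393, p.395 («coincides with Δ_a in (2.19) if U = 1»)] -/
theorem trLiftY_liftY_of_commute {X Y : Type} [Fintype X] (M : Matrix Y X ℝ) (T : Y → X → 𝔸ˣ) (hT : ∀ y x, Commute E (T y x : 𝔸))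
    (f : X → ℝ) : trLiftY M T (liftY f E) = liftY (M *ᵥ f) E := by
  rw [← liftMatY_liftY]
  funext y
  rw [trLiftY_apply, liftMatY_apply]
  refine Finset.sum_congr rfl fun x _ => ?_
  rw [liftY_apply, R_smul_of_commute (hT y x)]

/-- the gradient transporters of a background with values in `⟨g⟩` are powers of `g`. [cite: Balaban1985BackgroundPropagators, (3.3) p.390, bookkeeping] -/
theorem gradT_mem_zpowers (hU : ∀ μ x, U μ x ∈ Subgroup.zpowers g) (b : FBondY i) (z : SiteY i) : gradT i U b z ∈ Subgroup.zpowers g := by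
  unfold gradT
  split_ifs
  · exact hU _ _
  · exact one_mem _

/-- the curl transporters are powers of `g`. [cite: Balaban1985BackgroundPropagators, (3.4) p.391, bookkeeping] -/
theorem curlT_mem_zpowers (hU : ∀ μ x, U μ x ∈ Subgroup.zpowers g) (p : PlaqY i) (b : FBondY i) : curlT i U p b ∈ Subgroup.zpowers g := by
  unfold curlT
  split_ifs
  · exact hU _ _
  · exact hU _ _
  · exact one_mem _

/-- the transporters of the primed contour variables are powers of `g`. [cite: Balaban1985BackgroundPropagators, (3.2) p.390, bookkeeping] -/
theorem edgeParY_mem_zpowers (hU : ∀ μ x, U μ x ∈ Subgroup.zpowers g) (p : PlaqY i) (m : Fin 4) : edgeParY i U p m ∈ Subgroup.zpowers g := by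
  fin_cases m
  · exact hU _ _
  · exact one_mem _
  · exact one_mem _
  · exact hU _ _

/-- the plaquette holonomies are powers of `g`. [cite: Balaban1985BackgroundPropagators, (3.1) p.390, bookkeeping] -/
theorem holY_mem_zpowers (hU : ∀ μ x, U μ x ∈ Subgroup.zpowers g) (p : PlaqY i) : holY i U p ∈ Subgroup.zpowers g :=
  mul_mem (mul_mem (mul_mem (hU _ _) (hU _ _)) (inv_mem (hU _ _))) (inv_mem (hU _ _))

/-- `E` commutes with `Im U(∂p)`. [cite: Balaban1985BackgroundPropagators, (3.7) p.391, bookkeeping] -/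
theorem commute_imHolY (hEg : Commute E (g : 𝔸)) (hU : ∀ μ x, U μ x ∈ Subgroup.zpowers g) (p : PlaqY i) : Commute E (imHolY i U p) := by
  unfold imHolY
  exact ((commute_of_mem_zpowers hEg (holY_mem_zpowers i hU p)).sub_right
    (commute_of_mem_zpowers hEg (inv_mem (holY_mem_zpowers i hU p)))).smul_right _

/-- ★ `D*_U(a ⊗ E) = (∂*a) ⊗ E`. [cite: Balaban1985BackgroundPropagators, (3.8) p.392] -/
theorem divY_liftY (hEg : Commute E (g : 𝔸)) (hU : ∀ μ x, U μ x ∈ Subgroup.zpowers g) (a : FBondY i → ℝ) :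
    divY i U (liftY a E) = liftY (divK i *ᵥ a) E :=
  trLiftY_liftY_of_commute (divK i) _ (fun z b => commute_of_mem_zpowers hEg (inv_mem (gradT_mem_zpowers i hU b z))) a

/-- ★ `D_U(a ⊗ E) = (∂a) ⊗ E` (bond → plaquette). [cite: Balaban1985BackgroundPropagators, (3.4) p.391] -/
theorem curlY_liftY (hEg : Commute E (g : 𝔸)) (hU : ∀ μ x, U μ x ∈ Subgroup.zpowers g) (a : FBondY i → ℝ) :
    curlY i U (liftY a E) = liftY (curlK i *ᵥ a) E :=
  trLiftY_liftY_of_commute (curlK i) _ (fun p b => commute_of_mem_zpowers hEg (curlT_mem_zpowers i hU p b)) a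

/-- ★ `Q(U)(a ⊗ E) = (Qa) ⊗ E` for any bond transporter table transporting inside `⟨g⟩` at `U`. [cite: Balaban1985BackgroundPropagators, (3.12)–(3.14) pp.392–393] -/
theorem QY_liftY (hEg : Commute E (g : 𝔸)) {parB : BondParY 𝔸 i} (hparB : ∀ y x, parB U y x ∈ Subgroup.zpowers g) (a : FBondY i → ℝ) :
    QY i parB U (liftY a E) = liftY (qK i *ᵥ a) E :=
  trLiftY_liftY_of_commute (qK i) _ (fun _ _ => commute_of_mem_zpowers hEg (hparB _ _)) a

/-- ★ the Jordan insertion `𝒦_U` of (3.10) KILLS `c ⊗ E` when `E·Re U(∂p) = 0 = Re U(∂p)·E` on every plaquette.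
[cite: Balaban1985BackgroundPropagators, (3.7) p.391, (3.10) p.392] -/
theorem jordanY_liftY_eq_zero (hre : ∀ p, E * reHolY i U p = 0 ∧ reHolY i U p * E = 0) (c : PlaqY i → ℝ) : jordanY i U (liftY c E) = 0 := by
  funext p
  rw [jordanY_apply, liftY_apply, smul_mul_assoc, mul_smul_comm, (hre p).1, (hre p).2, smul_zero, add_zero, smul_zero, Pi.zero_apply]

omit [CompleteSpace 𝔸] in
/-- the commutator insertion `X ↦ i[X, M]` vanishes on `X` commuting with `M`. [cite: Balaban1985BackgroundPropagators, (3.10) p.392, bookkeeping] -/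
theorem commY_apply_of_commute {M X : 𝔸} (h : Commute X M) : commY M X = 0 := by
  simp only [commY, LinearMap.smul_apply, LinearMap.sub_apply, LinearMap.mulRight_apply, LinearMap.mulLeft_apply, h.eq, sub_self, smul_zero]

/-- the primed contour variables of `a ⊗ E` lie on the line `ℂE`. [cite: Balaban1985BackgroundPropagators, (3.2) p.390] -/
theorem primeEdgeY_liftY (hEg : Commute E (g : 𝔸)) (hU : ∀ μ x, U μ x ∈ Subgroup.zpowers g) (p : PlaqY i) (l : Fin 4) (a : FBondY i → ℝ) :
    primeEdgeY i U p l (liftY a E) = (sgnY l * ((a (edgeY i p l) : ℝ) : ℂ)) • E := by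
  unfold primeEdgeY
  rw [LinearMap.smul_apply, LinearMap.comp_apply, LinearMap.proj_apply, liftY_apply]
  show sgnY l • R (edgeParY i U p l) (((a (edgeY i p l) : ℝ) : ℂ) • E) = _
  rw [R_smul_of_commute (commute_of_mem_zpowers hEg (edgeParY_mem_zpowers i hU p l)), smul_smul]

/-- ★ **THE COMMUTATOR PART `Δ′₂(U)` OF (3.10) VANISHES ON `a ⊗ E`**: every primed contour variable lies on `ℂE` and `Im U(∂p)` commutes with `E`.
[cite: Balaban1985BackgroundPropagators, (3.10) p.392] -/
theorem curv2Y_liftY_eq_zero (hEg : Commute E (g : 𝔸)) (hU : ∀ μ x, U μ x ∈ Subgroup.zpowers g) (a : FBondY i → ℝ) :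
    curv2Y i U (liftY a E) = 0 := by
  have hterm : ∀ (b : FBondY i) (p : PlaqY i) (m : Fin 4),
      (if edgeY i p m = b then
          sgnY m • (RL (edgeParY i U p m)⁻¹ ∘ₗ commY (((i.cf ^ 2 : ℝ) : ℂ) • imHolY i U p) ∘ₗ
            ((∑ l : Fin 4, (if m < l then primeEdgeY i U p l else 0)) - ∑ l : Fin 4, (if l < m then primeEdgeY i U p l else 0)))
        else 0) (liftY a E) = 0 := by
    intro b p m
    have hM : Commute E (((i.cf ^ 2 : ℝ) : ℂ) • imHolY i U p) := (commute_imHolY i hEg hU p).smul_right _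
    have hl : ∀ l : Fin 4, Commute (primeEdgeY i U p l (liftY a E)) (((i.cf ^ 2 : ℝ) : ℂ) • imHolY i U p) := fun l => by
      rw [primeEdgeY_liftY i hEg hU p l a]
      exact hM.smul_left _
    have hS : ∀ (q : Fin 4 → Prop) [DecidablePred q],
        Commute ((∑ l : Fin 4, (if q l then primeEdgeY i U p l else 0)) (liftY a E)) (((i.cf ^ 2 : ℝ) : ℂ) • imHolY i U p) := by
      intro q _
      rw [LinearMap.sum_apply]
      refine Commute.sum_left _ _ _ fun l _ => ?_
      split_ifs
      · exact hl l
      · rw [LinearMap.zero_apply]; exact Commute.zero_left _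
    split_ifs
    · rw [LinearMap.smul_apply, LinearMap.comp_apply, LinearMap.comp_apply, LinearMap.sub_apply,
        commY_apply_of_commute ((hS _).sub_left (hS _)), map_zero, smul_zero]
    · rfl
  funext b
  unfold curv2Y
  simp only [LinearMap.smul_apply, Pi.smul_apply, LinearMap.pi_apply, LinearMap.sum_apply, hterm, Finset.sum_const_zero, smul_zero,
    Pi.zero_apply]

/-- ★★ **THE WILSON HESSIAN `Δ(U) = D*_U 𝒦_U D_U + Δ′₂(U)` VANISHES ON `a ⊗ E`** at a background with values in `⟨g⟩`, for a direction `E` commuting with `g`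
and killed by `Re U(∂p)` on both sides. [cite: Balaban1985BackgroundPropagators, (3.10) p.392] -/
theorem hessY_liftY_eq_zero (hEg : Commute E (g : 𝔸)) (hU : ∀ μ x, U μ x ∈ Subgroup.zpowers g)
    (hre : ∀ p, E * reHolY i U p = 0 ∧ reHolY i U p * E = 0) (a : FBondY i → ℝ) : hessY i U (liftY a E) = 0 := by
  rw [hessY, LinearMap.add_apply, LinearMap.comp_apply, LinearMap.comp_apply, curlY_liftY i hEg hU a, jordanY_liftY_eq_zero i hre, map_zero,
    curv2Y_liftY_eq_zero i hEg hU a, add_zero]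

end ELines

/-! ## §3 The kernel vector: a real `a ≠ 0` with `∂*a = 0`, `Qa = 0` (census count), `Δ_a(U)(a ⊗ E) = 0`, `Δ_a(U)` not a unit, `G(U) = 0` -/

section Kernel

variable {d ℓ : ℕ} {hd : 1 ≤ d + 1} {hL : Odd (ℓ + 1) ∧ 1 < ℓ + 1} {b₀ b₁ : ℝ}
variable {𝔸 : Type} [NormedRing 𝔸] [NormedAlgebra ℂ 𝔸] [CompleteSpace 𝔸]
variable (i : KIdx d ℓ hd hL b₀ b₁) {g : 𝔸ˣ} {E : 𝔸} {U : CfgY 𝔸 i}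

/-- ★ **RANK–NULLITY ON THE FLAT KERNELS**: at every index of dimension `≥ 2` a NON-ZERO real bond function with `∂*a = 0` and `Qa = 0`
(gen 10's count `|sites| + |𝔅| < |bonds|`). [cite: Balaban1985BackgroundPropagators, (3.8) p.392, (3.12) p.392; Balaban1984PropagatorsII, (2.19)–(2.20) p.226] -/
theorem exists_real_kernel (hd1 : 1 ≤ d) : ∃ a : FBondY i → ℝ, a ≠ 0 ∧ divK i *ᵥ a = 0 ∧ qK i *ᵥ a = 0 := by
  have hlt : Module.finrank ℝ ((SiteY i → ℝ) × (IBondY i → ℝ)) < Module.finrank ℝ (FBondY i → ℝ) := by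
    rw [Module.finrank_prod, Module.finrank_pi, Module.finrank_pi, Module.finrank_pi]
    exact card_SiteY_add_card_IBondY_lt i hd1
  have hker := LinearMap.ker_ne_bot_of_finrank_lt (f := (Matrix.mulVecLin (divK i)).prod (Matrix.mulVecLin (qK i))) hlt
  obtain ⟨a, ha, ha0⟩ := (Submodule.ne_bot_iff _).mp hker
  rw [LinearMap.mem_ker, LinearMap.prod_apply, Prod.mk_eq_zero] at ha
  exact ⟨a, ha0, ha.1, ha.2⟩

omit [CompleteSpace 𝔸] in
/-- the lift of the zero function is zero. [cite: Balaban1985BackgroundPropagators, (3.39) p.397, bookkeeping] -/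
theorem liftY_zero {X : Type} : liftY (0 : X → ℝ) E = 0 := by
  funext x
  rw [liftY_apply, Pi.zero_apply, Complex.ofReal_zero, zero_smul, Pi.zero_apply]

omit [CompleteSpace 𝔸] in
/-- a non-zero real profile along a non-zero direction is a non-zero field. [cite: Balaban1985BackgroundPropagators, (3.39) p.397, bookkeeping] -/
theorem liftY_ne_zero {X : Type} {a : X → ℝ} (ha : a ≠ 0) (hE : E ≠ 0) : liftY a E ≠ 0 := by
  intro h
  apply ha
  funext x
  have hx := congr_fun h x
  rw [liftY_apply, Pi.zero_apply, smul_eq_zero] at hx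
  rcases hx with hx | hx
  · exact_mod_cast hx
  · exact absurd hx hE

/-- ★★ **`Δ_a(U)(a ⊗ E) = 0`** by (3.26): the gauge-fixing term and the averaging term vanish (`D*_U(a ⊗ E) = (∂*a) ⊗ E = 0`, `Q(U)(a ⊗ E) = (Qa) ⊗ E = 0`)
and the Hessian vanishes on `a ⊗ E` — for ANY site transport table `parS` and ANY site-propagator letter `Gp`. [cite: Balaban1985BackgroundPropagators, (3.26) p.395, (3.10) p.392] -/
theorem deltaAY_liftY_eq_zero (hEg : Commute E (g : 𝔸)) (hU : ∀ μ x, U μ x ∈ Subgroup.zpowers g)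
    (hre : ∀ p, E * reHolY i U p = 0 ∧ reHolY i U p * E = 0) (parS : SiteParY 𝔸 i) (Gp : SiteOpY 𝔸 i) {parB : BondParY 𝔸 i}
    (hparB : ∀ y x, parB U y x ∈ Subgroup.zpowers g) {a : FBondY i → ℝ} (ha : divK i *ᵥ a = 0) (hq : qK i *ᵥ a = 0) :
    deltaAY i parS parB Gp U (liftY a E) = 0 := by
  rw [deltaAY_apply_of_divY_QY_eq_zero i parS parB Gp U (by rw [divY_liftY i hEg hU a, ha, liftY_zero])
    (by rw [QY_liftY i hEg hparB a, hq, liftY_zero]), hessY_liftY_eq_zero i hEg hU hre a]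

/-- ★★★ **`Δ_a(U)` IS NOT A UNIT** at any background with values in `⟨g⟩` whose every `Re U(∂p)` kills a non-zero direction `E` commuting with `g` on both
sides (dimension `≥ 2`; any `parS`, `Gp`; `parB` transporting inside `⟨g⟩`). [cite: Balaban1985BackgroundPropagators, Thm 3.11 p.416 (the conclusion «Δ_a … positive definite», here its consequence «invertible» NEGATED outside (3.35)), (3.26)–(3.27) p.395] -/
theorem not_isUnit_deltaAY_of (hd1 : 1 ≤ d) (hE : E ≠ 0) (hEg : Commute E (g : 𝔸)) (hU : ∀ μ x, U μ x ∈ Subgroup.zpowers g)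
    (hre : ∀ p, E * reHolY i U p = 0 ∧ reHolY i U p * E = 0) (parS : SiteParY 𝔸 i) (Gp : SiteOpY 𝔸 i) {parB : BondParY 𝔸 i}
    (hparB : ∀ y x, parB U y x ∈ Subgroup.zpowers g) : ¬ IsUnit (deltaAY i parS parB Gp U) := by
  intro h
  obtain ⟨a, ha0, ha, hq⟩ := exists_real_kernel i hd1
  have hinj : Function.Injective (deltaAY i parS parB Gp U) := ((Module.End.isUnit_iff _).mp h).injective
  exact liftY_ne_zero ha0 hE (hinj (by rw [deltaAY_liftY_eq_zero i hEg hU hre parS Gp hparB ha hq, map_zero]))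

/-- ★★ hence (3.27)'s TOTAL letter `G(U) := Ring.inverse Δ_a(U)` READS ITS JUNK BRANCH `0` there. [cite: Balaban1985BackgroundPropagators, (3.27) p.395] -/
theorem GAY_eq_zero_of (hd1 : 1 ≤ d) (hE : E ≠ 0) (hEg : Commute E (g : 𝔸)) (hU : ∀ μ x, U μ x ∈ Subgroup.zpowers g)
    (hre : ∀ p, E * reHolY i U p = 0 ∧ reHolY i U p * E = 0) (parS : SiteParY 𝔸 i) (Gp : SiteOpY 𝔸 i) {parB : BondParY 𝔸 i}
    (hparB : ∀ y x, parB U y x ∈ Subgroup.zpowers g) : GAY i parS parB Gp U = 0 :=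
  Ring.inverse_non_unit _ (not_isUnit_deltaAY_of i hd1 hE hEg hU hre parS Gp hparB)

end Kernel

/-! ## §4 At the half-frustrated background: `E·(g + g⁻¹) = 0` is all that is asked of the direction -/

section Half

variable {d ℓ : ℕ} {hd : 1 ≤ d + 1} {hL : Odd (ℓ + 1) ∧ 1 < ℓ + 1} {b₀ b₁ : ℝ}
variable {𝔸 : Type} [NormedRing 𝔸] [NormedAlgebra ℂ 𝔸] [CompleteSpace 𝔸]
variable (i : KIdx d ℓ hd hL b₀ b₁) {g : 𝔸ˣ} {E : 𝔸}

/-- at the half-frustrated background `E·Re W(∂p) = 0 = Re W(∂p)·E` once `E` commutes with `g` and `E·(g + g⁻¹) = 0`.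
[cite: Balaban1985BackgroundPropagators, (3.7) p.391, bookkeeping] -/
theorem re_halfCfg (hEg : Commute E (g : 𝔸)) (hE2 : E * ((g : 𝔸) + ((g⁻¹ : 𝔸ˣ) : 𝔸)) = 0) (p : PlaqY i) :
    E * reHolY i (halfCfg i g) p = 0 ∧ reHolY i (halfCfg i g) p * E = 0 := by
  have h2' : ((g : 𝔸) + ((g⁻¹ : 𝔸ˣ) : 𝔸)) * E = 0 := by
    rw [← (hEg.add_right hEg.units_inv_right).eq, hE2]
  rw [reHolY_halfCfg, mul_smul_comm, smul_mul_assoc, hE2, h2', smul_zero]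
  exact ⟨rfl, rfl⟩

/-- ★★★ **`Δ_a(W)` IS NOT A UNIT AT THE HALF-FRUSTRATED BACKGROUND** (dimension `d + 1 ≥ 2`; any `parS`, `Gp`; `parB` transporting inside `⟨g⟩`), for every
unit `g` admitting a non-zero direction `E` with `Eg = gE`, `E(g + g⁻¹) = 0`. [cite: Balaban1985BackgroundPropagators, Thm 3.11 p.416, (3.26)–(3.27) p.395, (3.35) p.396] -/
theorem not_isUnit_deltaAY_halfCfg (hd1 : 1 ≤ d) (hE : E ≠ 0) (hEg : Commute E (g : 𝔸)) (hE2 : E * ((g : 𝔸) + ((g⁻¹ : 𝔸ˣ) : 𝔸)) = 0)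
    (parS : SiteParY 𝔸 i) (Gp : SiteOpY 𝔸 i) {parB : BondParY 𝔸 i} (hparB : ∀ y x, parB (halfCfg i g) y x ∈ Subgroup.zpowers g) :
    ¬ IsUnit (deltaAY i parS parB Gp (halfCfg i g)) :=
  not_isUnit_deltaAY_of i hd1 hE hEg (halfCfg_mem_zpowers i g) (re_halfCfg i hEg hE2) parS Gp hparB

/-- ★★ … and `G(W) = 0`. [cite: Balaban1985BackgroundPropagators, (3.27) p.395] -/
theorem GAY_halfCfg_eq_zero (hd1 : 1 ≤ d) (hE : E ≠ 0) (hEg : Commute E (g : 𝔸)) (hE2 : E * ((g : 𝔸) + ((g⁻¹ : 𝔸ˣ) : 𝔸)) = 0)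
    (parS : SiteParY 𝔸 i) (Gp : SiteOpY 𝔸 i) {parB : BondParY 𝔸 i} (hparB : ∀ y x, parB (halfCfg i g) y x ∈ Subgroup.zpowers g) :
    GAY i parS parB Gp (halfCfg i g) = 0 :=
  GAY_eq_zero_of i hd1 hE hEg (halfCfg_mem_zpowers i g) (re_halfCfg i hEg hE2) parS Gp hparB

/-- ★★★ the same at def-Y's TAXICAB bond transporters `parBY` (which transport inside any subgroup containing the background's values).
[cite: Balaban1985BackgroundPropagators, Thm 3.11 p.416, (3.26)–(3.27) p.395, (3.40) p.397] -/
theorem not_isUnit_deltaAY_halfCfg_parBY (hd1 : 1 ≤ d) (hE : E ≠ 0) (hEg : Commute E (g : 𝔸)) (hE2 : E * ((g : 𝔸) + ((g⁻¹ : 𝔸ˣ) : 𝔸)) = 0)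
    (parS : SiteParY 𝔸 i) (Gp : SiteOpY 𝔸 i) : ¬ IsUnit (deltaAY i parS (parBY i) Gp (halfCfg i g)) :=
  not_isUnit_deltaAY_halfCfg i hd1 hE hEg hE2 parS Gp fun y x => parBY_mem i (halfCfg_mem_zpowers i g) y x

/-- ★★ … and `G(W) = 0` at `parBY`. [cite: Balaban1985BackgroundPropagators, (3.27) p.395, (3.40) p.397] -/
theorem GAY_halfCfg_parBY_eq_zero (hd1 : 1 ≤ d) (hE : E ≠ 0) (hEg : Commute E (g : 𝔸)) (hE2 : E * ((g : 𝔸) + ((g⁻¹ : 𝔸ˣ) : 𝔸)) = 0)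
    (parS : SiteParY 𝔸 i) (Gp : SiteOpY 𝔸 i) : GAY i parS (parBY i) Gp (halfCfg i g) = 0 :=
  GAY_halfCfg_eq_zero i hd1 hE hEg hE2 parS Gp fun y x => parBY_mem i (halfCfg_mem_zpowers i g) y x

end Half

/-! ## §5 The matrix algebra `M_N(ℂ)`: `g = diag(i, −i, 1, …, 1) ∈ SU(N)`, `E = e₀₀`; the displayed binder at `G = SU(N)` NEGATED -/

section MatrixWitness

open scoped Matrix.Norms.L2Operator

variable {N : ℕ}

/-- the diagonal `(i, −i, 1, …, 1)`. [cite: Balaban1985Averaging, p.18 (G = SU(N)), dictionary] -/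
def suDiag (N : ℕ) : Fin N → ℂ := fun j => if (j : ℕ) = 0 then Complex.I else if (j : ℕ) = 1 then -Complex.I else 1

/-- entrywise `star v · v = 1`. [cite: Balaban1985Averaging, p.18, bookkeeping] -/
theorem star_suDiag_mul (j : Fin N) : star (suDiag N j) * suDiag N j = 1 := by
  unfold suDiag
  split_ifs <;> simp

/-- entrywise `v · star v = 1`. [cite: Balaban1985Averaging, p.18, bookkeeping] -/
theorem suDiag_mul_star (j : Fin N) : suDiag N j * star (suDiag N j) = 1 := by
  rw [mul_comm, star_suDiag_mul]

/-- ★ THE WITNESS UNIT `gSU N = diag(i, −i, 1, …, 1)` of `M_N(ℂ)` (inverse = conjugate diagonal). [cite: Balaban1985Averaging, p.18 (G = SU(N)), dictionary] -/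
def gSU (N : ℕ) : (Matrix (Fin N) (Fin N) ℂ)ˣ where
  val := Matrix.diagonal (suDiag N)
  inv := Matrix.diagonal (star (suDiag N))
  val_inv := by
    rw [Matrix.diagonal_mul_diagonal, ← Matrix.diagonal_one]
    exact congrArg Matrix.diagonal (funext fun j => suDiag_mul_star j)
  inv_val := by
    rw [Matrix.diagonal_mul_diagonal, ← Matrix.diagonal_one]
    exact congrArg Matrix.diagonal (funext fun j => star_suDiag_mul j)

/-- THE WITNESS DIRECTION `eSU N = e₀₀ = diag(1, 0, …, 0)`. [cite: Balaban1985BackgroundPropagators, (3.39) p.397 (directions E), dictionary] -/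
def eSU (N : ℕ) : Matrix (Fin N) (Fin N) ℂ := Matrix.diagonal fun j => if (j : ℕ) = 0 then 1 else 0

/-- `e₀₀` commutes with the diagonal witness. [cite: Balaban1985BackgroundPropagators, (3.1) p.390, bookkeeping] -/
theorem commute_eSU_gSU : Commute (eSU N) (gSU N : Matrix (Fin N) (Fin N) ℂ) := by
  show eSU N * Matrix.diagonal (suDiag N) = Matrix.diagonal (suDiag N) * eSU N
  rw [eSU, Matrix.diagonal_mul_diagonal, Matrix.diagonal_mul_diagonal]
  exact congrArg Matrix.diagonal (funext fun j => mul_comm _ _)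

/-- ★ `e₀₀ · (g + g⁻¹) = 0`: `g + g⁻¹ = diag(0, 0, 2, …, 2)`. [cite: Balaban1985BackgroundPropagators, (3.7) p.391 (Re U(∂p)), bookkeeping] -/
theorem eSU_mul_gSU_add_inv : eSU N * ((gSU N : Matrix (Fin N) (Fin N) ℂ) + (((gSU N)⁻¹ : (Matrix (Fin N) (Fin N) ℂ)ˣ) : Matrix (Fin N) (Fin N) ℂ)) = 0 := by
  show eSU N * (Matrix.diagonal (suDiag N) + Matrix.diagonal (star (suDiag N))) = 0
  rw [eSU, Matrix.diagonal_add, Matrix.diagonal_mul_diagonal, ← Matrix.diagonal_zero]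
  refine congrArg Matrix.diagonal (funext fun j => ?_)
  unfold suDiag
  simp only [Pi.star_apply]
  split_ifs <;> simp

/-- `e₀₀ ≠ 0` (`N ≥ 1`). [cite: Balaban1985BackgroundPropagators, (3.39) p.397, bookkeeping] -/
theorem eSU_ne_zero (hN : 1 ≤ N) : eSU N ≠ 0 := by
  intro h
  have h0 := congr_fun (congr_fun h ⟨0, hN⟩) ⟨0, hN⟩
  simp [eSU, Matrix.diagonal_apply_eq] at h0

/-- the witness is unitary. [cite: Balaban1985Averaging, p.18 (G ⊂ U(N)), bookkeeping] -/
theorem gSU_mem_unitaryGroup : (gSU N : Matrix (Fin N) (Fin N) ℂ) ∈ Matrix.unitaryGroup (Fin N) ℂ := by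
  rw [Matrix.mem_unitaryGroup_iff']
  show star (Matrix.diagonal (suDiag N)) * Matrix.diagonal (suDiag N) = 1
  rw [Matrix.star_eq_conjTranspose, Matrix.diagonal_conjTranspose, Matrix.diagonal_mul_diagonal, ← Matrix.diagonal_one]
  exact congrArg Matrix.diagonal (funext fun j => star_suDiag_mul j)

/-- `det diag(i, −i, 1, …, 1) = 1` (`N ≥ 2`). [cite: Balaban1985Averaging, p.18 (G = SU(N)), bookkeeping] -/
theorem det_gSU (hN : 2 ≤ N) : (gSU N : Matrix (Fin N) (Fin N) ℂ).det = 1 := by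
  show (Matrix.diagonal (suDiag N)).det = 1
  rw [Matrix.det_diagonal]
  obtain ⟨n, rfl⟩ : ∃ n, N = n + 2 := ⟨N - 2, by omega⟩
  rw [Fin.prod_univ_succ, Fin.prod_univ_succ]
  have h0 : suDiag (n + 2) 0 = Complex.I := by simp [suDiag]
  have h1 : suDiag (n + 2) (Fin.succ 0) = -Complex.I := by simp [suDiag]
  have h2 : ∀ j : Fin n, suDiag (n + 2) j.succ.succ = 1 := fun j => by simp [suDiag]
  rw [h0, h1, Finset.prod_congr rfl (fun j _ => h2 j), Finset.prod_const_one, mul_one, mul_neg, Complex.I_mul_I, neg_neg]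

/-- ★ THE WITNESS IS `SU(N)`-VALUED (`N ≥ 2`). [cite: Balaban1985Averaging, p.18 (G = SU(N))] -/
theorem gSU_mem_specialUnitaryUnits (hN : 2 ≤ N) : gSU N ∈ specialUnitaryUnits (Fin N) := by
  show (gSU N : Matrix (Fin N) (Fin N) ℂ) ∈ Matrix.specialUnitaryGroup (Fin N) ℂ
  rw [Matrix.mem_specialUnitaryGroup_iff]
  exact ⟨gSU_mem_unitaryGroup, det_gSU hN⟩

variable {d ℓ : ℕ} {hd : 1 ≤ d + 1} {hL : Odd (ℓ + 1) ∧ 1 < ℓ + 1} {b₀ b₁ : ℝ}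
variable (i : KIdx d ℓ hd hL b₀ b₁)

/-- ★★★ **`Δ_a(W)` IS NOT A UNIT AT THE `SU(N)` HALF-FRUSTRATED BACKGROUND** `W ∈ {1, diag(i, −i, 1, …)}` — every index of dimension `≥ 2`, every
`N ≥ 1`, every `parS`, `Gp`, every bond table transporting inside `⟨gSU N⟩`. [cite: Balaban1985BackgroundPropagators, Thm 3.11 p.416, (3.26)–(3.27) p.395, (3.35) p.396] -/
theorem not_isUnit_deltaAY_halfCfg_gSU (hd1 : 1 ≤ d) (hN : 1 ≤ N) (parS : SiteParY (Matrix (Fin N) (Fin N) ℂ) i)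
    (Gp : SiteOpY (Matrix (Fin N) (Fin N) ℂ) i) {parB : BondParY (Matrix (Fin N) (Fin N) ℂ) i}
    (hparB : ∀ y x, parB (halfCfg i (gSU N)) y x ∈ Subgroup.zpowers (gSU N)) :
    ¬ IsUnit (deltaAY i parS parB Gp (halfCfg i (gSU N))) :=
  not_isUnit_deltaAY_halfCfg i hd1 (eSU_ne_zero hN) commute_eSU_gSU eSU_mul_gSU_add_inv parS Gp hparB

/-- ★★★ **AN `SU(N)`-VALUED BACKGROUND AT WHICH `Δ_a(U)` IS NOT A UNIT AND `G(U) = 0`** (def-Y's `parBY`; any `parS`, `Gp`; `d + 1 ≥ 2`, `N ≥ 2`).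
[cite: Balaban1985BackgroundPropagators, Thm 3.11 p.416, (3.26)–(3.27) p.395, (3.35) p.396; Balaban1985Averaging, p.18] -/
theorem exists_su_not_isUnit_deltaAY (hd1 : 1 ≤ d) (hN : 2 ≤ N) (parS : SiteParY (Matrix (Fin N) (Fin N) ℂ) i)
    (Gp : SiteOpY (Matrix (Fin N) (Fin N) ℂ) i) :
    ∃ U : CfgY (Matrix (Fin N) (Fin N) ℂ) i, (∀ μ x, U μ x ∈ specialUnitaryUnits (Fin N)) ∧ ¬ IsUnit (deltaAY i parS (parBY i) Gp U)
      ∧ GAY i parS (parBY i) Gp U = 0 :=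
  ⟨halfCfg i (gSU N), halfCfg_mem i (gSU N) (gSU_mem_specialUnitaryUnits hN),
    not_isUnit_deltaAY_halfCfg_parBY i hd1 (eSU_ne_zero (by omega)) commute_eSU_gSU eSU_mul_gSU_add_inv parS Gp,
    GAY_halfCfg_parBY_eq_zero i hd1 (eSU_ne_zero (by omega)) commute_eSU_gSU eSU_mul_gSU_add_inv parS Gp⟩

/-- ★★★ **THE DISPLAYED LAW «`Δ_a(U)` a unit at every `G`-valued `U`» IS UNSATISFIABLE for every subgroup `G ∋ diag(i, −i, 1, …)`** (e.g. `SU(N)`, `U(N)`),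
at every index of dimension `≥ 2`, any `parS`, `Gp`, def-Y's `parBY`. [cite: Balaban1985BackgroundPropagators, Thm 3.11 p.416 («Under the assumptions of the Theorems 3.1–3.10»), Thm 3.1 p.397, (3.35) p.396] -/
theorem not_forall_mem_isUnit_deltaAY (hd1 : 1 ≤ d) (hN : 1 ≤ N) {G : Subgroup (Matrix (Fin N) (Fin N) ℂ)ˣ} (hg : gSU N ∈ G)
    (parS : SiteParY (Matrix (Fin N) (Fin N) ℂ) i) (Gp : SiteOpY (Matrix (Fin N) (Fin N) ℂ) i) :
    ¬ ∀ U : CfgY (Matrix (Fin N) (Fin N) ℂ) i, (∀ μ x, U μ x ∈ G) → IsUnit (deltaAY i parS (parBY i) Gp U) := fun h =>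
  not_isUnit_deltaAY_halfCfg_parBY i hd1 (eSU_ne_zero hN) commute_eSU_gSU eSU_mul_gSU_add_inv parS Gp (h _ (halfCfg_mem i (gSU N) hg))

/-- ★★★ **AT THE RECORD's LETTERS (`parSymY`, `parBY`, `G′ = GpY parSymY`) AND THE RECORD's GROUP `SU(N)`**: ONE member's instance of the Sect. B display
`hunitA : ∀ U, GVal SU(N) U → IsUnit (Δ_a(U))` is FALSE (`d + 1 ≥ 2`, `N ≥ 2`) — the law must be keyed to the class (3.35)–(3.36), as print keys Theorem 3.11.
[cite: Balaban1985BackgroundPropagators, Thm 3.11 p.416, Thm 3.1 p.397, (3.35)–(3.36) p.396, Sect. B p.407] -/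
theorem not_forall_su_isUnit_deltaAY_parSymY (hd1 : 1 ≤ d) (hN : 2 ≤ N) :
    ¬ ∀ U : CfgY (Matrix (Fin N) (Fin N) ℂ) i, (∀ μ x, U μ x ∈ specialUnitaryUnits (Fin N)) →
      IsUnit (deltaAY i (parSymY i) (parBY i) (GpY i (parSymY i)) U) :=
  not_forall_mem_isUnit_deltaAY i hd1 (by omega) (gSU_mem_specialUnitaryUnits hN) (parSymY i) (GpY i (parSymY i))

end MatrixWitness

end Literature.MathematicalPhysics.QuantumFieldTheory.Balaban1983to89.B9Thm311DeltaANotUnitWitness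

end
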